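import Literature.AnabelianGeometry.SemiGraphs.ArithTemperedGroupBranchPair
import Literature.AnabelianGeometry.SemiGraphs.ArithChartBranchAction
import HarnessLib

/-!
# [SemiAnbd] Def 5.1 (i) on the tempered chart, BRANCH form, for `Π^temp_𝔊 := π₁^temp(𝒢) ⋊^out Π_A`
# — the package `ArithChartBranchAction` ASSEMBLED at the outer semi-direct product

Mochizuki, *Semi-graphs of anabelioids*, Publ. RIMS **42** (2006) 221–322, §5 Def 5.1 (i) p. 62,
Prop 5.2 (iv) p. 64, p. 65 ll. 4–14; Prop 3.6 (iv) p. 39. [cite: MochizukiSemiAnbd2006, Def 5.1 (i), p. 62]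

PROOF-ONLY assembly (abc-iut cell, L3 sub-DAG `plan/L3/SUBDAG-SemiAnbd-Thm54.md`, producer row T54-B,
seat abc-iut-w4-d040 gen 3).  No definition, no new named fact.  The binder
`A : ArithChartBranchAction c ι aug actV actE actB` of the Thm 5.4 (i)∧(ii) umbrella
(`arithMaximalCompactStatementI_and_II_ofChart_of_branchActionCptAt`, ArithThm54OfBranchActionCpt.lean)
INHABITED at abc-iut-w4-d082's carrier `outerSemidirectProduct ρ = π₁^temp(𝒢) ⋊^out Π_A` with
`ι := toOuterSemidirectProduct ρ`, `aug := outerSemidirectProductSnd ρ` and the vertex/edge/branch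
actions read off `baseAct : Π_A → Aut 𝔾`:

* `arithChartBranchAction_outerAction` — the parent clauses are abc-iut-w4-d082's
  `arithChartAction_outerAction` (Prop 3.6 (iv) at `ρ_𝔾(a)` in the forms `hV`/`hE`, Def 5.1 (i)(c)
  `hopen`), the branch-granular clause (BR) is abc-iut-w4-d082's `conj_branchPair_outerAction` from the
  PAIR-LEVEL binder `hBR` (Prop 3.6 (iv) at `ρ_𝔾(a)` read on (host, branch-group) pairs).

Honest scope: the three Prop 3.6 (iv)-at-`ρ_𝔾(a)` binders `hV`/`hE`/`hBR` and `hopen` are NOT supplied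
here (they are derivable from an action of `Π_A` on the anabelioid data of `𝒢`, abc-iut-L3-t10's
`Hom.conj_of_chartPullbackWith_iso`, and are print's Def 5.1 (i)(b)(c)).  Nothing here takes a side on
[IUTchIII] Cor. 3.12; typed ≠ proved.
-/

namespace Literature.AnabelianGeometry.SemiGraphs

namespace ProfiniteSemiGraph

open Literature.AnabelianGeometry.EtaleTheta CategoryTheory

universe u w

variable {𝒢 : ProfiniteSemiGraph.{u}} (c : TemperedPiChart 𝒢)
  {PA : Type w} [Group PA] [TopologicalSpace PA] (ρ : PA →* TopOut c.G) (baseAct : PA →* Aut 𝒢.graph)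

/-- **Def 5.1 (i) on the chart in BRANCH form, for `Π^temp_𝔊 := π₁^temp(𝒢) ⋊^out Π_A`**: the package
`ArithChartBranchAction` (abc-iut-w4-d053) holds for `ι := toOuterSemidirectProduct ρ`,
`aug := outerSemidirectProductSnd ρ` and the actions of `baseAct`, GIVEN Prop 3.6 (iv) at `ρ_𝔾(a)` on
verticial subgroups (`hV`), on edge-like subgroups (`hE`), on (host, branch-group) PAIRS (`hBR`), and
Def 5.1 (i)(c) for `baseAct` (`hopen`): parent clauses by `arithChartAction_outerAction`, (BR) by
`conj_branchPair_outerAction` (both abc-iut-w4-d082). [cite: MochizukiSemiAnbd2006, Def 5.1 (i), p. 62] -/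
theorem arithChartBranchAction_outerAction
    (hV : ∀ (a : PA) (v : 𝒢.graph.Vertex) (H : Subgroup c.G), H ∈ verticialSubgroups c v →
      ∃ φ : contMulAut c.G, TopOut.mk c.G φ = ρ a ∧
        H.map (φ : MulAut c.G).toMonoidHom ∈ verticialSubgroups c ((baseAct a).hom.vertexMap v))
    (hE : ∀ (a : PA) (e : 𝒢.graph.Edge) (K : Subgroup c.G), K ∈ edgeLikeSubgroups c e →
      ∃ φ : contMulAut c.G, TopOut.mk c.G φ = ρ a ∧
        K.map (φ : MulAut c.G).toMonoidHom ∈ edgeLikeSubgroups c ((baseAct a).hom.edgeMap e))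
    (hopen : ∃ U : Subgroup PA, IsOpen (U : Set PA) ∧ ∀ a ∈ U,
      (∀ v, (baseAct a).hom.vertexMap v = v) ∧ (∀ e, (baseAct a).hom.edgeMap e = e) ∧
        ∀ b, (baseAct a).hom.branchMap b = b)
    (hBR : ∀ (a : PA) (b : 𝒢.graph.Branch) (v : 𝒢.graph.Vertex) (hb : 𝒢.graph.abuts b = some v)
      (φ : 𝒢.Gv v →ₜ* c.G), IsVerticialHom c v φ →
      ∃ Φ : contMulAut c.G, TopOut.mk c.G Φ = ρ a ∧
        ∃ φ' : 𝒢.Gv ((baseAct a).hom.vertexMap v) →ₜ* c.G,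
          IsVerticialHom c ((baseAct a).hom.vertexMap v) φ' ∧ ∃ x' : c.G,
            Subgroup.map (Φ : MulAut c.G).toMonoidHom φ.toMonoidHom.range =
              Subgroup.map (MulAut.conj x').toMonoidHom φ'.toMonoidHom.range ∧
            Subgroup.map (Φ : MulAut c.G).toMonoidHom
                (Subgroup.map φ.toMonoidHom (𝒢.branchSubgroup b v hb)) =
              Subgroup.map (MulAut.conj x').toMonoidHom
                (Subgroup.map φ'.toMonoidHom
                  (𝒢.branchSubgroup ((baseAct a).hom.branchMap b) ((baseAct a).hom.vertexMap v)
                    ((baseAct a).hom.abuts_branchMap b v hb)))) :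
    ArithChartBranchAction c (toOuterSemidirectProduct ρ) (outerSemidirectProductSnd ρ)
      (fun a v => (baseAct a).hom.vertexMap v) (fun a e => (baseAct a).hom.edgeMap e)
      (fun a b => (baseAct a).hom.branchMap b) where
  toArithChartAction := arithChartAction_outerAction c ρ baseAct hV hE hopen
  conj_branchPair g b v hb φ hφ x _ := conj_branchPair_outerAction c ρ baseAct hBR g b v hb φ hφ x

end ProfiniteSemiGraph

end Literature.AnabelianGeometry.SemiGraphs
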